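import Literature.MathematicalPhysics.QuantumFieldTheory.Balaban1983to89.B9Thm312WholeStepDirRegular
import Literature.MathematicalPhysics.QuantumFieldTheory.Balaban1983to89.B9SmoothHolderClassState

/-!
# `Balaban1983to89.B9Thm312WholeMembersRegular` — [B9] Theorem 3.12 (3.130)∕(3.138): THE (3.42)–(3.45) MEMBERS OF A ∈ {G, G₁} FROM A REGULAR STATE CLASS,
# FIRST RESOLVENT FORM ONLY — E∘A∘F = E∘G₀∘F + (E∘G₀∘T)∘(A∘F) with the right entry A∘F carried IN the state class 𝔖 and the one-step left-form member
# E∘G₀∘T read OUT of 𝔖; the [4]-(2.60) passage between the dimension-2 and dimension-1 states; the printed two-space shapes of the member lines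

T. Bałaban, *Propagators for lattice gauge theories in a background field*, Commun. Math. Phys. **99** (1985) 389–434 [`Balaban1985BackgroundPropagators`,
"B9"]; [4] = T. Bałaban, *Propagators and renormalization transformations for lattice gauge theories. II*, Commun. Math. Phys. **96** (1984) 223–250
[`Balaban1984PropagatorsII`].  statement-level skeleton of published theorems with citation tags; proofs where landed; nothing here is a claim about the
Yang–Mills mass gap.  Sequel of `B9Thm312WholeStepRegular` (g26: `StepS`, `hasMaj_right_of_stepS`, `hasMaj_read_of_state`), `B9SmoothHolderClassState` (g26:
the rescaling calculus) and `B9Thm312WholeStepDirRegular` (g27: the one-step left-form members out of 𝔖).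

THE PRINT.  p. 421–422: *"G = G₀(I − Δ′_πG₀)⁻¹ = Σ G₀(Δ′_πG₀)ⁿ (3.130) … convergence of the series (3.130), for α₀ sufficiently small, in all norms appearing on the
left-hand sides of the inequalities (3.42)–(3.47)"*; p. 423: *"G₁ = Σ G₀((Δ′_π + Δ⁽²⁾_π)G₀)ⁿ (3.138) … derivatives in the operator Δ′_π + Δ⁽²⁾_π which have to be applied
either to the operator on the right, or on the left"*; (3.42)–(3.45) pp. 397–398; p. 398 (remark after (3.47)): *"we may replace the factor (Lʲη)^α by (Lʲη)^β(L^{j′}η)^γ with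
β + γ = α"*; [4] (2.54) p. 233, Lemma 2.1 (2.60)–(2.61) p. 234.

THE POINT (dag-n06-l LOCATED-U8′, `U8S-PROGRAMME-MEMO.md`).  In print's induction over (3.138) the perturbation T = Δ′_π + Δ⁽²⁾_π is only ever applied to a REGULAR state
(a G₀-output carrying its Hölder sizes): the initial state G₀F (F ∈ {1, ∇\*_U, ∇\*_{U,μ}, D_U, Q\*}) is carried in the state class 𝔖, every further T is absorbed by the
next step G₀T : 𝔖 → 𝔖 (`StepS`), and a member E∘A∘F of A = Σ G₀(TG₀)ⁿ is read by the FIRST resolvent form A = G₀ + G₀TA: E∘A∘F = E∘G₀∘F + (E∘G₀∘T)(A∘F).  The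
second form A = G₀ + ATG₀ (today's `input44_of_step`, `tDd ∕ tDd1 ∕ tDv`: T∘G₀∘F INTO a sup class) has T's leading derivative un-absorbed and is not used.  THIS FILE:
* §1 ★ `hasMaj_left_rightS` — E∘A∘F : b₀ → b_out with (a + κ_S·θ′·A′·c)·e^{−rd} from E∘G₀∘F (a·e^{−ρ_a d}), E∘G₀∘T : 𝔖 → b_out (θ′·e^{−δ_K d}), A∘F : b₀ → 𝔖 (A′·e^{−ρ_A d})
  and A = G₀ + G₀TA (`B9Thm313WholeHolder.hasMaj_left_rightR` with the middle class FREED; the cut through 𝔖 costs κ_S = 𝔖.κ);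
* §2 THE MEMBER LINES IN PRINTED SHAPE (the two states 𝔖₂ = (Lʲη)⁻¹·𝔖₁ and 𝔖₁ related by `B9Thm312WholeStepDirRegular.stepS_up ∕ fieldS_up ∕ readS_up ∕ entryS_down`) from the right entries IN the state: ★ `entry0_of_stateS` ((3.42)₁ `|Aλ| ≦ K(Lʲη)²e^{−ρd}|λ|` from A : 𝔠⁽⁰⁾ → 𝔖₂ and the sup reading),
  ★ `entry1_of_stateS` ∕ `entry1d_of_stateS` ((3.42)₂ for ∇_UA, ∇_{U,ν}A from `he1 ∕ e1d`, the left step out of 𝔖₂ and A : 𝔠⁽⁰⁾ → 𝔖₂), ★ `entry2_of_stateS` ((3.42)₃ for A∇\* from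
  A∇\* : 𝔠_Y^{(0)} → 𝔖₁ and the sup reading of 𝔖₁), ★ `probe43L_of_stateS` ∕ `probe43R_of_stateS` ((3.43)), ★ `input44_of_stateS` ∕ `input45_of_stateS` ((3.44)∕(3.45) per direction pair,
  out of the input class, state 𝔖₁) and their pair-family packagings ★ `input44_family_of_stateS` ∕ `input45_family_of_stateS` (`hasMaj_familyOp'`, `sliceProbe_comp_familyOp`) —
  conclusions in EXACTLY the shapes `l2bd_entry0_of_sup ∕ l2bd_entry12_of_sup ∕ ineq343_345_of_majorants_pairM` consume.
HONEST SCOPE.  Bookkeeping over free block maps, a free state class and free letters; the step, the right entries, the readings and every G₀ member enter as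
HYPOTHESES of printed type (at the knit: g26's `stepS_of_lettersS`, `hasMaj_right_of_stepS`, `hasMaj_id_state`, the producers `B9SmoothHolderClassStateProducers`);
nothing of [B9]∕[4] asserted; no pin, no certificate edit; COUNT-NEUTRAL; N06 NOT discharged; one finite lattice at a time — nothing continuum ∕ OS ∕ mass gap.
Cell `pub-ymgap` (HUMAN RULING D-0062), Track A node N06 [B9], bundle F7 rows 20–21, seat `pub-ymgap-dag-n06-l` (g27), 2026-08-29.  NEW file; nothing landed is modified.
-/

namespace Literature.MathematicalPhysics.QuantumFieldTheory.Balaban1983to89.B9Thm312WholeMembersRegular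

open Literature.MathematicalPhysics.QuantumFieldTheory.Balaban1983to89
open Finset B6RandomWalk B6RandomWalkHom B9Thm34Ext B11SectG B9SectDSup B9Thm312Whole B9Thm312WholeLeaf B9Thm312WholeClasses
open B9RWSums343Holder B9RWSums343to347Whole B9RWSums346Schur B9Thm312WholeDir B9Thm313WholeHolder B9Thm313WholeDir
open B9RWSums344InputFam B9RWSums346SecondDiff B9Thm312WholeHolder B9Thm312WholeLeft
open B9Thm312WholeStepFrom3131 B9Thm312WholeLeftStepFrom3131 B9Thm312WholeStepDirFrom3131 B9Thm312WholeStepRegular B9Thm312WholeStepDirRegular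
open B9SmoothHolderClassState B9PerturbationMajorantAlgebra

noncomputable section

variable {g : B9.Geometry} {B : B9.Backgrounds} {X Y Z W PX PY P : Type}
variable [Fintype X] [Fintype Y] [Fintype Z] [Fintype W] [Fintype PX] [Fintype PY] [Fintype P] [Fintype g.Site]
variable {R₀ : ℝ} {H₀ : Prop}

/-! ## §1 The first resolvent form through a free state class -/

omit [Fintype X] [Fintype Y] [Fintype Z] [Fintype W] [Fintype PX] [Fintype PY] [Fintype P] in
/-- ★ **THE LEFT-AND-RIGHT ENTRY THROUGH A REGULAR STATE** (the first resolvent form of (3.130)∕(3.138)): E∘G₀∘F : b₀ → b_out (a·e^{−ρ_a d}), the one-step member E∘G₀∘T : 𝔖 → b_out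
(θ′·e^{−δ_K d}), the right entry A∘F : b₀ → 𝔖 (A′·e^{−ρ_A d}) and A = G₀ + G₀TA give E∘A∘F : b₀ → b_out the majorant (a + κ_S·θ′·A′·c)·e^{−rd} for 0 ≦ r ≦ min(ρ_a, ρ_A), r + σ ≦ δ_K
(`B9Thm313WholeHolder.hasMaj_left_rightR` is the case 𝔖 = 𝔠^{(s)}, κ_S = 1). [cite: Balaban1985BackgroundPropagators, (3.130) p.421 + (3.138) p.423 + Thm 3.12 p.423; Balaban1984PropagatorsII, (2.54) p.233 + Lemma 2.1 (2.61) p.234] -/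
theorem hasMaj_left_rightS {F₀ F₁ : Type} [AddCommGroup F₀] [Module ℝ F₀] [AddCommGroup F₁] [Module ℝ F₁] (hG : GeoOK g)
    {b₀ : BlockNorm (toB6 g R₀ H₀) F₀} {𝔖 : BlockNorm (toB6 g R₀ H₀) (X → ℝ)} {bout : BlockNorm (toB6 g R₀ H₀) F₁}
    {G0 T A : Module.End ℝ (X → ℝ)} {E : (X → ℝ) →ₗ[ℝ] F₁} {Fop : F₀ →ₗ[ℝ] (X → ℝ)}
    {θ' a A' δK ρa ρA r σ c : ℝ} (hrow : RowSum (toB6 g R₀ H₀) σ c) (hθ' : 0 ≤ θ') (ha : 0 ≤ a) (hA' : 0 ≤ A')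
    (hr : 0 ≤ r) (hra : r ≤ ρa) (hrA : r ≤ ρA) (hrδ : r + σ ≤ δK)
    (hKE : HasMaj 𝔖 bout (E ∘ₗ G0 ∘ₗ T) (fun a b => θ' * Real.exp (-(δK * g.dist a b))))
    (hEF : HasMaj b₀ bout (E ∘ₗ G0 ∘ₗ Fop) (fun y y' => a * Real.exp (-(ρa * g.dist y y'))))
    (hAF : HasMaj b₀ 𝔖 (A ∘ₗ Fop) (fun y y' => A' * Real.exp (-(ρA * g.dist y y'))))
    (hfix : A = G0 + G0 ∘ₗ T ∘ₗ A) :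
    HasMaj b₀ bout (E ∘ₗ A ∘ₗ Fop) (fun y y' => (a + 𝔖.κ * θ' * A' * c) * Real.exp (-(r * g.dist y y'))) := by
  -- adapted from `B9Thm313WholeHolder.hasMaj_left_rightR` (the middle class freed)
  have htri : Triangle254 (toB6 g R₀ H₀) := fun a b c => hG.tri a b c
  have h2 : HasMaj b₀ bout ((E ∘ₗ G0 ∘ₗ T) ∘ₗ (A ∘ₗ Fop)) (fun y y' => 𝔖.κ * θ' * A' * c * Real.exp (-(r * g.dist y y'))) :=
    hasMaj_comp_exp htri hG.dnn hrow hθ' hA' hr hrA hrδ hKE hAF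
  have hsum := (hEF.of_rate_le hG.dnn ha hra).add h2
  have hop : E ∘ₗ A ∘ₗ Fop = E ∘ₗ G0 ∘ₗ Fop + (E ∘ₗ G0 ∘ₗ T) ∘ₗ (A ∘ₗ Fop) := by
    refine LinearMap.ext fun v => ?_
    have hpt : A (Fop v) = G0 (Fop v) + G0 (T (A (Fop v))) := by
      conv_lhs => rw [hfix]
      simp only [LinearMap.add_apply, LinearMap.comp_apply]
    simp only [LinearMap.comp_apply, LinearMap.add_apply]
    conv_lhs => rw [hpt]
    rw [map_add]
  rw [hop]
  exact hsum.mono fun y y' => le_of_eq (by simp only [toB6_dist]; ring)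


/-! ## §2 The member lines of A ∈ {G, G₁} in printed shape, from the right entries in the state -/

section Members

omit [Fintype Y] [Fintype Z] [Fintype W] [Fintype PX] [Fintype PY] [Fintype P] in
/-- ★ **(3.42)₁ FOR A ∈ {G, G₁} FROM THE STATE**: the right entry `A : 𝔠⁽⁰⁾ → 𝔖` (A′·e^{−ρ_A d} — g26 `hasMaj_right_of_stepS` with F = 1 and the producer `G₀ : 𝔠⁽⁰⁾ → 𝔖`)
followed by the sup reading `id : 𝔖 → 𝔠^{(−2)}` (C_R·e^{−r_R d}) is the printed line |(Aλ)(x)| ≦ κ_S·C_R·A′·c·(Lʲη)²·e^{−ρd(y,y′)}|λ|, x ∈ Δ(y), supp λ ⊂ Δ(y′) (ρ ≦ ρ_A, ρ + σ ≦ r_R) — the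
input `hm0` of `l2bd_entry0_of_sup`. [cite: Balaban1985BackgroundPropagators, Thm 3.12 p.423 + (3.42) p.397 + (3.130) p.421; Balaban1984PropagatorsII, (2.52)–(2.54) pp.232–233 + Lemma 2.1 (2.61) p.234] -/
theorem entry0_of_stateS (hG : GeoOK g) {blk : X → g.Site} {𝔖 : BlockNorm (toB6 g R₀ H₀) (X → ℝ)} {A : Module.End ℝ (X → ℝ)}
    {A' ρA CR rR ρ σ c : ℝ} (hrow : RowSum (toB6 g R₀ H₀) σ c) (hc : 0 ≤ c) (hA' : 0 ≤ A') (hCR : 0 ≤ CR) (hρ : 0 ≤ ρ) (hρA : ρ ≤ ρA) (hρR : ρ + σ ≤ rR)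
    (hA0 : HasMaj (cNorm R₀ H₀ blk hG.lenle 0) 𝔖 A (fun a b => A' * Real.exp (-(ρA * g.dist a b))))
    (hRd : HasMaj 𝔖 (cNormR R₀ H₀ blk hG.lenle (-2)) LinearMap.id (fun a b => CR * Real.exp (-(rR * g.dist a b)))) :
    HasMajorant (g := toB6 g R₀ H₀) blk A (fun a b => 𝔖.κ * CR * A' * c * g.len a ^ 2 * Real.exp (-(ρ * g.dist a b))) := by
  have hRd' : HasMaj 𝔖 (cNorm R₀ H₀ blk hG.lenle 2) LinearMap.id (fun a b => CR * Real.exp (-(rR * g.dist a b))) := by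
    intro y' μ hμ y
    have hb := hRd y' μ hμ y
    rwa [show (-2 : ℝ) = -((2 : ℕ) : ℝ) by norm_num, cNormR_loc_neg_natCast hG] at hb
  have h := hasMaj_read_of_state hG hrow hA' hCR hρ hρA hρR hA0 hRd'
  rw [LinearMap.id_comp] at h
  have hK0 : 0 ≤ 𝔖.κ * CR * A' * c := mul_nonneg (mul_nonneg (mul_nonneg 𝔖.κ_nonneg hCR) hA') hc
  have h' := hasMajorantHom_of_hasMaj_cNorm hG (fun a b => mul_nonneg hK0 (Real.exp_nonneg _)) h
  rw [hasMajorantHom_iff] at h'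
  refine hasMajorant_mono (g := toB6 g R₀ H₀) blk h' fun a b => le_of_eq ?_
  simp only [wt, pow_zero, inv_one, mul_one]
  ring

omit [Fintype Z] [Fintype W] [Fintype PX] [Fintype PY] [Fintype P] in
/-- ★ **(3.42)₂ FOR A ∈ {G, G₁} FROM THE STATE, FIRST RESOLVENT FORM**: ∇_UA = ∇_UG₀ + (∇_UG₀T)A with Theorem 3.3's (3.42)₂ `he1`, the left step ∇_UG₀T : 𝔖 → 𝔠_Y⁽¹⁾ (θ′·e^{−δ_K d},
`B9Thm312WholeStepDirRegular.stepDS_of_lettersS`) and the right entry A : 𝔠⁽⁰⁾ → 𝔖 (A′·e^{−ρ_A d}): |(∇_UAλ)(b)| ≦ (B₀ + κ_S·θ′·A′·c)·Lʲη·e^{−ρd}|λ| (ρ ≦ min(δ₀, ρ_A), ρ + σ ≦ δ_K)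
— the input `hm1` of `l2bd_entry12_of_sup`. [cite: Balaban1985BackgroundPropagators, Thm 3.12 p.423 + (3.42) p.397 + (3.130) p.421; Balaban1984PropagatorsII, (2.54) p.233 + Lemma 2.1 (2.61) p.234] -/
theorem entry1_of_stateS (hG : GeoOK g) {blk : X → g.Site} {blkY : Y → g.Site} {𝔖 : BlockNorm (toB6 g R₀ H₀) (X → ℝ)}
    {G0 T A : Module.End ℝ (X → ℝ)} {Dop : (X → ℝ) →ₗ[ℝ] (Y → ℝ)} {θ' B₀ A' δ₀ δK ρA ρ σ c : ℝ} (hrow : RowSum (toB6 g R₀ H₀) σ c) (hc : 0 ≤ c)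
    (hθ' : 0 ≤ θ') (hB₀ : 0 ≤ B₀) (hA' : 0 ≤ A') (hρ : 0 ≤ ρ) (hρ₀ : ρ ≤ δ₀) (hρA : ρ ≤ ρA) (hρδ : ρ + σ ≤ δK)
    (he1 : HasMajorantHom (g := toB6 g R₀ H₀) blk blkY (Dop ∘ₗ G0) (fun a b => B₀ * g.len a * Real.exp (-(δ₀ * g.dist a b))))
    (hSD : HasMaj 𝔖 (cNorm R₀ H₀ blkY hG.lenle 1) (Dop ∘ₗ G0 ∘ₗ T) (fun a b => θ' * Real.exp (-(δK * g.dist a b))))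
    (hA0 : HasMaj (cNorm R₀ H₀ blk hG.lenle 0) 𝔖 A (fun a b => A' * Real.exp (-(ρA * g.dist a b))))
    (hfix : A = G0 + G0 ∘ₗ T ∘ₗ A) :
    HasMajorantHom (g := toB6 g R₀ H₀) blk blkY (Dop ∘ₗ A)
      (fun a b => (B₀ + 𝔖.κ * θ' * A' * c) * g.len a * Real.exp (-(ρ * g.dist a b))) := by
  have hD0 := hasMaj_DG0_cNorm (R₀ := R₀) (H₀ := H₀) hG hB₀ he1
  have hD0' : HasMaj (cNorm R₀ H₀ blk hG.lenle 0) (cNorm R₀ H₀ blkY hG.lenle 1) (Dop ∘ₗ G0 ∘ₗ LinearMap.id)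
      (fun a b => B₀ * Real.exp (-(δ₀ * g.dist a b))) := by rw [LinearMap.comp_id]; exact hD0
  have hA0' : HasMaj (cNorm R₀ H₀ blk hG.lenle 0) 𝔖 (A ∘ₗ LinearMap.id) (fun a b => A' * Real.exp (-(ρA * g.dist a b))) := by
    rw [LinearMap.comp_id]; exact hA0
  have h := hasMaj_left_rightS hG hrow hθ' hB₀ hA' hρ hρ₀ hρA hρδ hSD hD0' hA0' hfix
  rw [LinearMap.comp_id] at h
  have hK0 : 0 ≤ B₀ + 𝔖.κ * θ' * A' * c := add_nonneg hB₀ (mul_nonneg (mul_nonneg (mul_nonneg 𝔖.κ_nonneg hθ') hA') hc)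
  have h' := hasMajorantHom_of_hasMaj_cNorm hG (fun a b => mul_nonneg hK0 (Real.exp_nonneg _)) h
  refine hasMajorantHom_mono (g := toB6 g R₀ H₀) blk blkY h' fun a b => le_of_eq ?_
  simp only [wt, pow_zero, inv_one, mul_one, pow_one]
  ring

omit [Fintype Y] [Fintype Z] [Fintype W] [Fintype PX] [Fintype PY] [Fintype P] in
/-- ★ **(3.42)₂ PER DIRECTION, ∇_{U,ν}A FROM THE STATE** (`entry1_of_stateS` with ∇_U ↦ ∇_{U,ν}: from `Thm33G0Dir.e1d`, the step derivative ∇_{U,ν}G₀T : 𝔖 → 𝔠⁽¹⁾ of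
`stepDdS_of_lettersS` and A : 𝔠⁽⁰⁾ → 𝔖) — the input `h1d` of the (3.44) family. [cite: Balaban1985BackgroundPropagators, Thm 3.12 p.423 + (3.42) p.397 + (3.39) p.397 + (3.130) p.421; Balaban1984PropagatorsII, (2.54) p.233 + Lemma 2.1 (2.61) p.234] -/
theorem entry1d_of_stateS (hG : GeoOK g) {blk : X → g.Site} {𝔖 : BlockNorm (toB6 g R₀ H₀) (X → ℝ)}
    {G0 T A Dν : Module.End ℝ (X → ℝ)} {θ' B₀ A' δ₀ δK ρA ρ σ c : ℝ} (hrow : RowSum (toB6 g R₀ H₀) σ c) (hc : 0 ≤ c)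
    (hθ' : 0 ≤ θ') (hB₀ : 0 ≤ B₀) (hA' : 0 ≤ A') (hρ : 0 ≤ ρ) (hρ₀ : ρ ≤ δ₀) (hρA : ρ ≤ ρA) (hρδ : ρ + σ ≤ δK)
    (he1d : HasMajorantHom (g := toB6 g R₀ H₀) blk blk (Dν ∘ₗ G0) (fun a b => B₀ * g.len a * Real.exp (-(δ₀ * g.dist a b))))
    (hSD : HasMaj 𝔖 (cNorm R₀ H₀ blk hG.lenle 1) (Dν ∘ₗ G0 ∘ₗ T) (fun a b => θ' * Real.exp (-(δK * g.dist a b))))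
    (hA0 : HasMaj (cNorm R₀ H₀ blk hG.lenle 0) 𝔖 A (fun a b => A' * Real.exp (-(ρA * g.dist a b))))
    (hfix : A = G0 + G0 ∘ₗ T ∘ₗ A) :
    HasMajorantHom (g := toB6 g R₀ H₀) blk blk (Dν ∘ₗ A)
      (fun a b => (B₀ + 𝔖.κ * θ' * A' * c) * g.len a * Real.exp (-(ρ * g.dist a b))) :=
  entry1_of_stateS hG hrow hc hθ' hB₀ hA' hρ hρ₀ hρA hρδ he1d hSD hA0 hfix

omit [Fintype Z] [Fintype W] [Fintype PX] [Fintype PY] [Fintype P] in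
/-- ★ **(3.42)₃ FOR A ∈ {G, G₁} FROM THE DIMENSION-1 STATE**: the right entry `A∇\* : 𝔠_Y^{(0)} → 𝔖₁` (A′·e^{−ρ_A d} — `hasMaj_right_of_stepS` at 𝔖₁ with the producer `G₀∇\* : 𝔠_Y^{(0)} → 𝔖₁`
from Theorem 3.3's `e2` + (3.43)₂ `h43R`) followed by the sup reading `id : 𝔖₁ → 𝔠^{(−1)}` (C_R·e^{−r_R d}) is the printed line |(A∇\*J)(x)| ≦ κ_S·C_R·A′·c·Lʲη·e^{−ρd}|J| — the input
`hm2` of `l2bd_entry12_of_sup`. [cite: Balaban1985BackgroundPropagators, Thm 3.12 p.423 + (3.42) p.397 + (3.130) p.421; Balaban1984PropagatorsII, (2.52)–(2.54) pp.232–233 + Lemma 2.1 (2.61) p.234] -/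
theorem entry2_of_stateS (hG : GeoOK g) {blk : X → g.Site} {blkY : Y → g.Site} {𝔖₁ : BlockNorm (toB6 g R₀ H₀) (X → ℝ)} {A : Module.End ℝ (X → ℝ)}
    {Ds : (Y → ℝ) →ₗ[ℝ] (X → ℝ)} {A' ρA CR rR ρ σ c : ℝ} (hrow : RowSum (toB6 g R₀ H₀) σ c) (hc : 0 ≤ c) (hA' : 0 ≤ A') (hCR : 0 ≤ CR)
    (hρ : 0 ≤ ρ) (hρA : ρ ≤ ρA) (hρR : ρ + σ ≤ rR)
    (hA2 : HasMaj (cNormR R₀ H₀ blkY hG.lenle 0) 𝔖₁ (A ∘ₗ Ds) (fun a b => A' * Real.exp (-(ρA * g.dist a b))))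
    (hRd : HasMaj 𝔖₁ (cNormR R₀ H₀ blk hG.lenle (-1)) LinearMap.id (fun a b => CR * Real.exp (-(rR * g.dist a b)))) :
    HasMajorantHom (g := toB6 g R₀ H₀) blkY blk (A ∘ₗ Ds) (fun a b => 𝔖₁.κ * CR * A' * c * g.len a * Real.exp (-(ρ * g.dist a b))) := by
  have h := hasMaj_read_of_state hG hrow hA' hCR hρ hρA hρR hA2 hRd
  rw [LinearMap.id_comp] at h
  have hK0 : 0 ≤ 𝔖₁.κ * CR * A' * c := mul_nonneg (mul_nonneg (mul_nonneg 𝔖₁.κ_nonneg hCR) hA') hc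
  have h' := hasMajorantHom_of_hasMaj_cNormR hG (fun a b => mul_nonneg hK0 (Real.exp_nonneg _)) h
  refine hasMajorantHom_mono (g := toB6 g R₀ H₀) blkY blk h' fun a b => le_of_eq ?_
  simp only [Real.rpow_zero, mul_one, neg_neg, Real.rpow_one]
  ring

omit [Fintype Y] [Fintype Z] [Fintype W] [Fintype PX] [Fintype P] in
/-- ★ **THE LEFT (3.43) MEMBER Φ^Y_β∇_UA FROM THE STATE, FIRST RESOLVENT FORM**: Φ^Y_β∇_UA = Φ^Y_β∇_UG₀ + (Φ^Y_β∇_UG₀T)A with Theorem 3.3's `h43L`, the probe of the left step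
Φ^Y_β∇_UG₀T : 𝔖 → 𝔠_{PY}^{(β−1)} (θ_H·e^{−δ_K d}, `probeYS_of_lettersS`) and A : 𝔠⁽⁰⁾ → 𝔖: ‖probes of ζ∇_UAλ‖ ≦ (B_h + κ_S·θ_H·A′·c)·(Lʲη)^{1−β}·e^{−ρd}|λ| — the input `hL` of
`ineq343_345_of_majorants_pairM`. [cite: Balaban1985BackgroundPropagators, Thm 3.12 p.423 + (3.43) p.398 + (3.130) p.421 + p.423; Balaban1984PropagatorsII, (2.54) p.233 + Lemma 2.1 (2.61) p.234] -/
theorem probe43L_of_stateS (hG : GeoOK g) {blk : X → g.Site} (𝔭 : HolderProbes g B X Y PX PY) {𝔖 : BlockNorm (toB6 g R₀ H₀) (X → ℝ)}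
    {G0 T A : Module.End ℝ (X → ℝ)} {Dop : (X → ℝ) →ₗ[ℝ] (Y → ℝ)} {U : B.Cfg} {θH Bh A' β δ₀ δK ρA ρ σ c : ℝ} (hrow : RowSum (toB6 g R₀ H₀) σ c)
    (hc : 0 ≤ c) (hθH : 0 ≤ θH) (hBh : 0 ≤ Bh) (hA' : 0 ≤ A') (hρ : 0 ≤ ρ) (hρ₀ : ρ ≤ δ₀) (hρA : ρ ≤ ρA) (hρδ : ρ + σ ≤ δK)
    (h43 : HasMajorantHom (g := toB6 g R₀ H₀) blk 𝔭.blkPY (𝔭.ΦY U β ∘ₗ (Dop ∘ₗ G0))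
      (fun (a b : g.Site) => Bh * g.len a ^ (1 - β) * Real.exp (-(δ₀ * g.dist a b))))
    (hP : HasMaj 𝔖 (cNormR R₀ H₀ 𝔭.blkPY hG.lenle (β - 1)) ((𝔭.ΦY U β ∘ₗ Dop ∘ₗ G0) ∘ₗ T) (fun a b => θH * Real.exp (-(δK * g.dist a b))))
    (hA0 : HasMaj (cNorm R₀ H₀ blk hG.lenle 0) 𝔖 A (fun a b => A' * Real.exp (-(ρA * g.dist a b))))
    (hfix : A = G0 + G0 ∘ₗ T ∘ₗ A) :
    HasMajorantHom (g := toB6 g R₀ H₀) blk 𝔭.blkPY (𝔭.ΦY U β ∘ₗ (Dop ∘ₗ A))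
      (fun (a b : g.Site) => (Bh + 𝔖.κ * θH * A' * c) * g.len a ^ (1 - β) * Real.exp (-(ρ * g.dist a b))) := by
  have hE0 : HasMaj (cNormR R₀ H₀ blk hG.lenle 0) (cNormR R₀ H₀ 𝔭.blkPY hG.lenle (β - 1)) ((𝔭.ΦY U β ∘ₗ Dop) ∘ₗ G0 ∘ₗ LinearMap.id)
      (fun a b => Bh * Real.exp (-(δ₀ * g.dist a b))) := by
    rw [LinearMap.comp_id]; exact (hasMaj_probe_cNormR_of_hom hG hBh h43).congr fun μ => rfl
  have hP' : HasMaj 𝔖 (cNormR R₀ H₀ 𝔭.blkPY hG.lenle (β - 1)) ((𝔭.ΦY U β ∘ₗ Dop) ∘ₗ G0 ∘ₗ T)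
      (fun a b => θH * Real.exp (-(δK * g.dist a b))) := hP.congr fun μ => rfl
  have hA0' : HasMaj (cNormR R₀ H₀ blk hG.lenle 0) 𝔖 (A ∘ₗ LinearMap.id) (fun a b => A' * Real.exp (-(ρA * g.dist a b))) := by
    rw [LinearMap.comp_id]
    have h := hasMaj_toR_src hG hA0
    rwa [Nat.cast_zero, neg_zero] at h
  have h := hasMaj_left_rightS hG hrow hθH hBh hA' hρ hρ₀ hρA hρδ hP' hE0 hA0' hfix
  rw [LinearMap.comp_id] at h
  have hK0 : 0 ≤ Bh + 𝔖.κ * θH * A' * c := add_nonneg hBh (mul_nonneg (mul_nonneg (mul_nonneg 𝔖.κ_nonneg hθH) hA') hc)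
  have h' := hasMajorantHom_of_hasMaj_cNormR hG (fun a b => mul_nonneg hK0 (Real.exp_nonneg _)) h
  have h'' : HasMajorantHom (g := toB6 g R₀ H₀) blk 𝔭.blkPY (𝔭.ΦY U β ∘ₗ (Dop ∘ₗ A))
      (fun a b => (Bh + 𝔖.κ * θH * A' * c) * Real.exp (-(ρ * g.dist a b)) * g.len a ^ (-(β - 1)) * g.len b ^ (0 : ℝ)) := h'
  refine hasMajorantHom_mono (g := toB6 g R₀ H₀) blk 𝔭.blkPY h'' fun a b => le_of_eq ?_
  simp only [Real.rpow_zero, mul_one, show -(β - 1) = 1 - β by ring]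
  ring

omit [Fintype X] [Fintype Z] [Fintype W] [Fintype PY] [Fintype P] in
/-- ★ **THE RIGHT (3.43) MEMBER Φ^X_βA∇\* FROM THE DIMENSION-1 STATE, FIRST RESOLVENT FORM**: Φ^X_βA∇\* = Φ^X_βG₀∇\* + (Φ^X_βG₀T)(A∇\*) with Theorem 3.3's (3.43)₂ `h43R`, the probe of the
step Φ^X_βG₀T : 𝔖₁ → 𝔠_{PX}^{(β−1)} (θ_H·e^{−δ_K d}: `probeXS_of_lettersS` at 𝔖₂ moved up by `fieldS_up`) and the right entry A∇\* : 𝔠_Y^{(0)} → 𝔖₁ (A′·e^{−ρ_A d}): ‖probes of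
ζA∇\*J‖ ≦ (B_h + κ_S·θ_H·A′·c)·(Lʲη)^{1−β}·e^{−ρd}|J| — the input `hRt` of `ineq343_345_of_majorants_pairM`. [cite: Balaban1985BackgroundPropagators, Thm 3.12 p.423 + (3.43) p.398 + (3.130) p.421 + p.423; Balaban1984PropagatorsII, (2.54) p.233 + Lemma 2.1 (2.61) p.234] -/
theorem probe43R_of_stateS (hG : GeoOK g) {blkY : Y → g.Site} (𝔭 : HolderProbes g B X Y PX PY) {𝔖₁ : BlockNorm (toB6 g R₀ H₀) (X → ℝ)}
    {G0 T A : Module.End ℝ (X → ℝ)} {Ds : (Y → ℝ) →ₗ[ℝ] (X → ℝ)} {U : B.Cfg} {θH Bh A' β δ₀ δK ρA ρ σ c : ℝ} (hrow : RowSum (toB6 g R₀ H₀) σ c)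
    (hc : 0 ≤ c) (hθH : 0 ≤ θH) (hBh : 0 ≤ Bh) (hA' : 0 ≤ A') (hρ : 0 ≤ ρ) (hρ₀ : ρ ≤ δ₀) (hρA : ρ ≤ ρA) (hρδ : ρ + σ ≤ δK)
    (h43 : HasMajorantHom (g := toB6 g R₀ H₀) blkY 𝔭.blkPX (𝔭.ΦX U β ∘ₗ (G0 ∘ₗ Ds))
      (fun (a b : g.Site) => Bh * g.len a ^ (1 - β) * Real.exp (-(δ₀ * g.dist a b))))
    (hP : HasMaj 𝔖₁ (cNormR R₀ H₀ 𝔭.blkPX hG.lenle (β - 1)) ((𝔭.ΦX U β ∘ₗ G0) ∘ₗ T) (fun a b => θH * Real.exp (-(δK * g.dist a b))))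
    (hA2 : HasMaj (cNormR R₀ H₀ blkY hG.lenle 0) 𝔖₁ (A ∘ₗ Ds) (fun a b => A' * Real.exp (-(ρA * g.dist a b))))
    (hfix : A = G0 + G0 ∘ₗ T ∘ₗ A) :
    HasMajorantHom (g := toB6 g R₀ H₀) blkY 𝔭.blkPX (𝔭.ΦX U β ∘ₗ (A ∘ₗ Ds))
      (fun (a b : g.Site) => (Bh + 𝔖₁.κ * θH * A' * c) * g.len a ^ (1 - β) * Real.exp (-(ρ * g.dist a b))) := by
  have hE0 : HasMaj (cNormR R₀ H₀ blkY hG.lenle 0) (cNormR R₀ H₀ 𝔭.blkPX hG.lenle (β - 1)) (𝔭.ΦX U β ∘ₗ G0 ∘ₗ Ds)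
      (fun a b => Bh * Real.exp (-(δ₀ * g.dist a b))) := (hasMaj_probe_cNormR_of_hom hG hBh h43).congr fun μ => rfl
  have hP' : HasMaj 𝔖₁ (cNormR R₀ H₀ 𝔭.blkPX hG.lenle (β - 1)) (𝔭.ΦX U β ∘ₗ G0 ∘ₗ T)
      (fun a b => θH * Real.exp (-(δK * g.dist a b))) := hP.congr fun μ => rfl
  have h := hasMaj_left_rightS hG hrow hθH hBh hA' hρ hρ₀ hρA hρδ hP' hE0 hA2 hfix
  have hK0 : 0 ≤ Bh + 𝔖₁.κ * θH * A' * c := add_nonneg hBh (mul_nonneg (mul_nonneg (mul_nonneg 𝔖₁.κ_nonneg hθH) hA') hc)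
  have h' := hasMajorantHom_of_hasMaj_cNormR hG (fun a b => mul_nonneg hK0 (Real.exp_nonneg _)) h
  have h'' : HasMajorantHom (g := toB6 g R₀ H₀) blkY 𝔭.blkPX (𝔭.ΦX U β ∘ₗ (A ∘ₗ Ds))
      (fun a b => (Bh + 𝔖₁.κ * θH * A' * c) * Real.exp (-(ρ * g.dist a b)) * g.len a ^ (-(β - 1)) * g.len b ^ (0 : ℝ)) := h'
  refine hasMajorantHom_mono (g := toB6 g R₀ H₀) blkY 𝔭.blkPX h'' fun a b => le_of_eq ?_
  simp only [Real.rpow_zero, mul_one, show -(β - 1) = 1 - β by ring]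
  ring

omit [Fintype X] [Fintype Z] [Fintype W] [Fintype PX] [Fintype PY] [Fintype P] in
/-- ★ **(3.44) FOR A ∈ {G, G₁} PER PAIR OF LETTERS, FROM THE DIMENSION-1 STATE, FIRST RESOLVENT FORM**: E∘A∘F = E∘G₀∘F + (E∘G₀∘T)(A∘F) with Theorem 3.3's (3.44) member E∘G₀∘F out of the input
class `bHε` INTO the sharp blocks (`h44`: B_i·e^{−δ₀d}), the left step EG₀T : 𝔖₁ → 𝔠_{Y}^{(0)} (θ′·e^{−δ_K d}, `stepDdS_of_lettersS` moved up) and the right entry A∘F : bHε → 𝔖₁ (A′·e^{−ρ_A d}: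
`hasMaj_right_of_stepS` at 𝔖₁ with the producer G₀F out of `bHε`): E∘A∘F : bHε → sharp blocks with (B_i + κ_S·θ′·A′·c)·e^{−ρ₂d} (ρ₂ ≦ min(δ₀, ρ_A), ρ₂ + σ ≦ δ_K).
[cite: Balaban1985BackgroundPropagators, Thm 3.12 p.423 + (3.44) p.398 + (3.130) p.421 + p.423; Balaban1984PropagatorsII, (2.54) p.233 + Lemma 2.1 (2.61) p.234] -/
theorem input44_of_stateS (hG : GeoOK g) {blkY : Y → g.Site} {bHε : BlockNorm (toB6 g R₀ H₀) (Y → ℝ)} {𝔖₁ : BlockNorm (toB6 g R₀ H₀) (X → ℝ)}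
    {G0 T A : Module.End ℝ (X → ℝ)} {Dop : (X → ℝ) →ₗ[ℝ] (Y → ℝ)} {Ds : (Y → ℝ) →ₗ[ℝ] (X → ℝ)}
    {θ' Bi A' δ₀ δK ρA ρ₂ σ c : ℝ} (hrow : RowSum (toB6 g R₀ H₀) σ c)
    (hθ' : 0 ≤ θ') (hBi : 0 ≤ Bi) (hA' : 0 ≤ A') (hρ₂ : 0 ≤ ρ₂) (hρ₂δ : ρ₂ ≤ δ₀) (hρ₂A : ρ₂ ≤ ρA) (hρ₂K : ρ₂ + σ ≤ δK)
    (h44 : HasMaj bHε (BlockNorm.ofBlocks (toB6 g R₀ H₀) blkY) (Dop ∘ₗ (G0 ∘ₗ Ds)) (fun (a b : g.Site) => Bi * Real.exp (-(δ₀ * g.dist a b))))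
    (hSD : HasMaj 𝔖₁ (cNormR R₀ H₀ blkY hG.lenle 0) (Dop ∘ₗ G0 ∘ₗ T) (fun a b => θ' * Real.exp (-(δK * g.dist a b))))
    (hAF : HasMaj bHε 𝔖₁ (A ∘ₗ Ds) (fun a b => A' * Real.exp (-(ρA * g.dist a b))))
    (hfix : A = G0 + G0 ∘ₗ T ∘ₗ A) :
    HasMaj bHε (BlockNorm.ofBlocks (toB6 g R₀ H₀) blkY) (Dop ∘ₗ (A ∘ₗ Ds))
      (fun (a b : g.Site) => (Bi + 𝔖₁.κ * θ' * A' * c) * Real.exp (-(ρ₂ * g.dist a b))) := by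
  have h44' : HasMaj bHε (cNormR R₀ H₀ blkY hG.lenle 0) (Dop ∘ₗ G0 ∘ₗ Ds) (fun (a b : g.Site) => Bi * Real.exp (-(δ₀ * g.dist a b))) := by
    intro y' μ hμ y
    rw [cNormR_loc, Real.rpow_zero, one_mul]
    exact h44 y' μ hμ y
  have h := hasMaj_left_rightS hG hrow hθ' hBi hA' hρ₂ hρ₂δ hρ₂A hρ₂K hSD h44' hAF hfix
  exact (hasMaj_of_out_zero h).congr fun μ => rfl

omit [Fintype X] [Fintype Y] [Fintype Z] [Fintype W] [Fintype PX] [Fintype P] in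
/-- ★ **(3.45) FOR A ∈ {G, G₁} PER PAIR OF LETTERS, FROM THE DIMENSION-1 STATE, FIRST RESOLVENT FORM**: with a probe E (Φ^X_β∘∇_{U,ν} at the knit): E∘A∘F = E∘G₀∘F + (E∘G₀∘T)(A∘F) from
Theorem 3.3's (3.45) member out of `bHε` INTO the probe blocks at weight (Lʲη)^{−β} (`h45`: B_i2·(Lʲη)^{−β}·e^{−δ₀d}), the probe of the step's derivative EG₀T : 𝔖₁ → 𝔠_P^{(β)} (θ_H·e^{−δ_K d},
`probeXdS_of_lettersS` moved up) and A∘F : bHε → 𝔖₁: E∘A∘F : bHε → probe blocks with (B_i2 + κ_S·θ_H·A′·c)·(Lʲη)^{−β}·e^{−ρ₂d}.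
[cite: Balaban1985BackgroundPropagators, Thm 3.12 p.423 + (3.45) p.398 + (3.40) p.397 + (3.130) p.421 + p.423; Balaban1984PropagatorsII, (2.54) p.233 + Lemma 2.1 (2.61) p.234] -/
theorem input45_of_stateS (hG : GeoOK g) {blkP : PY → g.Site} {bHε : BlockNorm (toB6 g R₀ H₀) (Y → ℝ)} {𝔖₁ : BlockNorm (toB6 g R₀ H₀) (X → ℝ)}
    {G0 T A : Module.End ℝ (X → ℝ)} {E : (X → ℝ) →ₗ[ℝ] (PY → ℝ)} {Ds : (Y → ℝ) →ₗ[ℝ] (X → ℝ)}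
    {θH Bi2 A' β δ₀ δK ρA ρ₂ σ c : ℝ} (hrow : RowSum (toB6 g R₀ H₀) σ c)
    (hθH : 0 ≤ θH) (hBi2 : 0 ≤ Bi2) (hA' : 0 ≤ A') (hρ₂ : 0 ≤ ρ₂) (hρ₂δ : ρ₂ ≤ δ₀) (hρ₂A : ρ₂ ≤ ρA) (hρ₂K : ρ₂ + σ ≤ δK)
    (h45 : HasMaj bHε (BlockNorm.ofBlocks (toB6 g R₀ H₀) blkP) (E ∘ₗ (G0 ∘ₗ Ds))
      (fun (a b : g.Site) => Bi2 * g.len a ^ (-β) * Real.exp (-(δ₀ * g.dist a b))))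
    (hP : HasMaj 𝔖₁ (cNormR R₀ H₀ blkP hG.lenle β) (E ∘ₗ G0 ∘ₗ T) (fun a b => θH * Real.exp (-(δK * g.dist a b))))
    (hAF : HasMaj bHε 𝔖₁ (A ∘ₗ Ds) (fun a b => A' * Real.exp (-(ρA * g.dist a b))))
    (hfix : A = G0 + G0 ∘ₗ T ∘ₗ A) :
    HasMaj bHε (BlockNorm.ofBlocks (toB6 g R₀ H₀) blkP) (E ∘ₗ (A ∘ₗ Ds))
      (fun (a b : g.Site) => (Bi2 + 𝔖₁.κ * θH * A' * c) * g.len a ^ (-β) * Real.exp (-(ρ₂ * g.dist a b))) := by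
  -- the (3.45) member of G₀ with the weight (Lʲη)^{−β} moved into the target class 𝔠_P^{(β)}
  have h45' : HasMaj bHε (cNormR R₀ H₀ blkP hG.lenle β) (E ∘ₗ G0 ∘ₗ Ds) (fun (a b : g.Site) => Bi2 * Real.exp (-(δ₀ * g.dist a b))) := by
    intro y' μ hμ y
    have hb := h45 y' μ hμ y
    dsimp only at hb
    rw [cNormR_loc]
    have hpos : 0 < g.len y ^ β := Real.rpow_pos_of_pos (hG.lenpos y) β
    rw [Real.rpow_neg (hG.lenle y) β] at hb
    refine (mul_le_mul_of_nonneg_left hb hpos.le).trans (le_of_eq ?_)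
    field_simp
  have h := hasMaj_left_rightS hG hrow hθH hBi2 hA' hρ₂ hρ₂δ hρ₂A hρ₂K hP h45' hAF hfix
  -- back to the sharp blocks with the weight (Lʲη)^{−β} in the kernel
  intro y' μ hμ y
  have hb := h y' μ hμ y
  rw [cNormR_loc] at hb
  dsimp only at hb ⊢
  have hpos : 0 < g.len y ^ β := Real.rpow_pos_of_pos (hG.lenpos y) β
  have hb' := (le_div_iff₀ hpos).mpr (((mul_comm _ _).le).trans hb)
  refine hb'.trans (le_of_eq ?_)
  rw [Real.rpow_neg (hG.lenle y) β, div_eq_mul_inv]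
  ring

omit [Fintype Y] [Fintype Z] [Fintype W] [Fintype PX] [Fintype PY] in
/-- ★ **(3.44) FOR A ∈ {G, G₁} ON THE PACKAGED PAIR FAMILY, FROM THE STATE** (the first-form twin of `B9Thm312WholeDir.input44_family_of_step`): per pair q = (ν, μ), ∇_{U,ν}A∇\*_{U,μ} by
`input44_of_stateS` from `Thm33G0Dir.h44m q`, the step derivative ∇_{U,ν}G₀T out of 𝔖₁ and the right entry A∇\*_{U,μ} INTO 𝔖₁; packaged without a |P| factor (`hasMaj_familyOp'`):
the family read from `bHX ε` into the sharp blocks of X × (P × P) has majorant (B_i + κ_S·θ′·A′·c)·e^{−ρ₂d} — the input `h44` of `ineq343_345_of_majorants_pairM`.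
[cite: Balaban1985BackgroundPropagators, Thm 3.12 p.423 + (3.44) p.398 + (3.39) p.397 + (3.130) p.421; Balaban1984PropagatorsII, (2.54) p.233 + Lemma 2.1 (2.61) p.234] -/
theorem input44_family_of_stateS (hG : GeoOK g) {blk : X → g.Site} {bHε : BlockNorm (toB6 g R₀ H₀) (X → ℝ)} {𝔖₁ : BlockNorm (toB6 g R₀ H₀) (X → ℝ)}
    {G0 T A : Module.End ℝ (X → ℝ)} {Dd Dds : P → Module.End ℝ (X → ℝ)}
    {θ' Bi A' δ₀ δK ρA ρ₂ σ c : ℝ} (hrow : RowSum (toB6 g R₀ H₀) σ c)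
    (hθ' : 0 ≤ θ') (hBi : 0 ≤ Bi) (hA' : 0 ≤ A') (hρ₂ : 0 ≤ ρ₂) (hρ₂δ : ρ₂ ≤ δ₀) (hρ₂A : ρ₂ ≤ ρA) (hρ₂K : ρ₂ + σ ≤ δK)
    (h44m : ∀ q : P × P, HasMaj bHε (BlockNorm.ofBlocks (toB6 g R₀ H₀) blk) (Dd q.1 ∘ₗ (G0 ∘ₗ Dds q.2))
      (fun (a b : g.Site) => Bi * Real.exp (-(δ₀ * g.dist a b))))
    (hSDd : ∀ ν : P, HasMaj 𝔖₁ (cNormR R₀ H₀ blk hG.lenle 0) (Dd ν ∘ₗ G0 ∘ₗ T) (fun a b => θ' * Real.exp (-(δK * g.dist a b))))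
    (hAF : ∀ μ : P, HasMaj bHε 𝔖₁ (A ∘ₗ Dds μ) (fun a b => A' * Real.exp (-(ρA * g.dist a b))))
    (hfix : A = G0 + G0 ∘ₗ T ∘ₗ A) :
    HasMaj bHε (BlockNorm.ofBlocks (toB6 g R₀ H₀) (blk ∘ Prod.fst))
      (familyOp (fun q : P × P => Dd q.1 ∘ₗ (A ∘ₗ Dds q.2)))
      (fun (a b : g.Site) => (Bi + 𝔖₁.κ * θ' * A' * c) * Real.exp (-(ρ₂ * g.dist a b))) := by
  have hc : 0 ≤ c ∨ IsEmpty g.Site := by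
    by_cases hne : Nonempty g.Site
    · exact Or.inl (hrow.nonneg hne.some)
    · exact Or.inr (not_nonempty_iff.mp hne)
  rcases hc with hc | hemp
  swap
  · intro y' μ hμ y
    exact (hemp.false y).elim
  have hK0 : 0 ≤ Bi + 𝔖₁.κ * θ' * A' * c := add_nonneg hBi (mul_nonneg (mul_nonneg (mul_nonneg 𝔖₁.κ_nonneg hθ') hA') hc)
  exact hasMaj_familyOp' (R := R₀) (H := H₀) blk (fun a b => mul_nonneg hK0 (Real.exp_nonneg _))
    fun q => input44_of_stateS hG hrow hθ' hBi hA' hρ₂ hρ₂δ hρ₂A hρ₂K (h44m q) (hSDd q.1) (hAF q.2) hfix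

omit [Fintype X] [Fintype Y] [Fintype Z] [Fintype W] [Fintype PY] in
/-- ★ **(3.45) FOR A ∈ {G, G₁} ON THE PACKAGED PAIR FAMILY, PROBES SLICED, FROM THE STATE** (the first-form twin of `B9Thm312WholeDir.input45_family_of_step`): per pair by
`input45_of_stateS` (E := Φ^X_β∘∇_{U,ν}) from `Thm33G0Dir.h45m q`, the probe of the step's derivative out of 𝔖₁ and A∇\*_{U,μ} INTO 𝔖₁; then `sliceProbe_comp_familyOp` and
`hasMaj_familyOp'`: `sliceProbe Φ^X_β ∘ familyOp (q ↦ ∇_{q.1}A∇\*_{q.2})` read from `bHX (β+ε)` into the probe blocks has majorant (B_i2 + κ_S·θ_H·A′·c)·(Lʲη)^{−β}·e^{−ρ₂d} — the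
input `h45` of `ineq343_345_of_majorants_pairM`. [cite: Balaban1985BackgroundPropagators, Thm 3.12 p.423 + (3.45) p.398 + (3.39)–(3.40) p.397 + (3.130) p.421; Balaban1984PropagatorsII, (2.54) p.233 + Lemma 2.1 (2.61) p.234] -/
theorem input45_family_of_stateS (hG : GeoOK g) {blkP : PX → g.Site} {bHε : BlockNorm (toB6 g R₀ H₀) (X → ℝ)}
    {𝔖₁ : BlockNorm (toB6 g R₀ H₀) (X → ℝ)} {G0 T A : Module.End ℝ (X → ℝ)} {Dd Dds : P → Module.End ℝ (X → ℝ)} {Φ : (X → ℝ) →ₗ[ℝ] (PX → ℝ)}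
    {θH Bi2 A' β δ₀ δK ρA ρ₂ σ c : ℝ} (hrow : RowSum (toB6 g R₀ H₀) σ c)
    (hθH : 0 ≤ θH) (hBi2 : 0 ≤ Bi2) (hA' : 0 ≤ A') (hρ₂ : 0 ≤ ρ₂) (hρ₂δ : ρ₂ ≤ δ₀) (hρ₂A : ρ₂ ≤ ρA) (hρ₂K : ρ₂ + σ ≤ δK)
    (h45m : ∀ q : P × P, HasMaj bHε (BlockNorm.ofBlocks (toB6 g R₀ H₀) blkP) (Φ ∘ₗ (Dd q.1 ∘ₗ (G0 ∘ₗ Dds q.2)))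
      (fun (a b : g.Site) => Bi2 * g.len a ^ (-β) * Real.exp (-(δ₀ * g.dist a b))))
    (hPd : ∀ ν : P, HasMaj 𝔖₁ (cNormR R₀ H₀ blkP hG.lenle β) ((Φ ∘ₗ Dd ν ∘ₗ G0) ∘ₗ T) (fun a b => θH * Real.exp (-(δK * g.dist a b))))
    (hAF : ∀ μ : P, HasMaj bHε 𝔖₁ (A ∘ₗ Dds μ) (fun a b => A' * Real.exp (-(ρA * g.dist a b))))
    (hfix : A = G0 + G0 ∘ₗ T ∘ₗ A) :
    HasMaj bHε (BlockNorm.ofBlocks (toB6 g R₀ H₀) (blkP ∘ Prod.fst))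
      (sliceProbe Φ ∘ₗ familyOp (fun q : P × P => Dd q.1 ∘ₗ (A ∘ₗ Dds q.2)))
      (fun (a b : g.Site) => (Bi2 + 𝔖₁.κ * θH * A' * c) * g.len a ^ (-β) * Real.exp (-(ρ₂ * g.dist a b))) := by
  have hc : 0 ≤ c ∨ IsEmpty g.Site := by
    by_cases hne : Nonempty g.Site
    · exact Or.inl (hrow.nonneg hne.some)
    · exact Or.inr (not_nonempty_iff.mp hne)
  rcases hc with hc | hemp
  swap
  · intro y' μ hμ y
    exact (hemp.false y).elim
  have hK0 : 0 ≤ Bi2 + 𝔖₁.κ * θH * A' * c := add_nonneg hBi2 (mul_nonneg (mul_nonneg (mul_nonneg 𝔖₁.κ_nonneg hθH) hA') hc)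
  rw [sliceProbe_comp_familyOp]
  refine hasMaj_familyOp' (R := R₀) (H := H₀) blkP
    (fun a b => mul_nonneg (mul_nonneg hK0 (Real.rpow_nonneg (hG.lenle a) _)) (Real.exp_nonneg _)) fun q => ?_
  have h45' : HasMaj bHε (BlockNorm.ofBlocks (toB6 g R₀ H₀) blkP) ((Φ ∘ₗ Dd q.1) ∘ₗ (G0 ∘ₗ Dds q.2))
      (fun (a b : g.Site) => Bi2 * g.len a ^ (-β) * Real.exp (-(δ₀ * g.dist a b))) := (h45m q).congr fun μ => rfl
  have hP' : HasMaj 𝔖₁ (cNormR R₀ H₀ blkP hG.lenle β) ((Φ ∘ₗ Dd q.1) ∘ₗ G0 ∘ₗ T) (fun a b => θH * Real.exp (-(δK * g.dist a b))) :=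
    (hPd q.1).congr fun μ => rfl
  have h := input45_of_stateS hG hrow hθH hBi2 hA' hρ₂ hρ₂δ hρ₂A hρ₂K h45' hP' (hAF q.2) hfix
  exact h.congr fun μ => rfl

end Members

end

end Literature.MathematicalPhysics.QuantumFieldTheory.Balaban1983to89.B9Thm312WholeMembersRegular
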